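import Summits.ABC.IUTFork.Cor312HullGainRamifiedGlobal
import Literature.IUT.LogVolume.UnitLogBallTorsionCensusDyadic
import HarnessLib

/-!
# [IUTchIII] Cor. 3.12, statement — the DYADIC packets: for `√−1 ∈ F` ([IUTchI] Def. 3.1 (a)) the (Ind1)/(Ind2)-hull of the
# print-normalised sharp setting of record has STRICTLY POSITIVE local Θ-volume over `p = 2`, so `−deĝ_lgp(P_Θ) < −|log(Θ)|`

PROOF-ONLY coda (abc-iut cell, Cor. 3.12 sub-crew, seat abc-iut-c312-5, gen 5; row «RAMIFIED-GAIN», dyadic instance) of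
`Cor312HullGainRamified` (p439709) / `Cor312HullGainRamifiedGlobal` (p440607); TAKES NO SIDE on [IUTchIII] Cor. 3.12; no
definition, no `Prop` fact, no instance. Those files give strictly positive, idele-free hull inflation at a packet over a
prime `p` NOT under `S` having a place `v` with `2 ≤ e_v ≤ i+2`. For GENUINE initial Θ-data both hypotheses are met at
`p = 2`: [IUTchI] Def. 3.1 (a) requires `√−1 ∈ F` (abc-iut-L5-t2 `InitialThetaData.sqrt_neg_one_mem`), so EVERY place of
`F` over `2` has absolute ramification index `≥ 2` (campaign-S `two_le_absRamificationIdx_two_of_sq_eq_neg_one`,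
Neukirch II (7.13)), and Def. 3.1 (b) takes `𝕍^bad_mod` "of odd residue characteristic"
(`InitialThetaData.VbadMod_odd`), so no place of `S` lies over `2`. Hence:

* `two_le_absRamificationIdx_rescaledCompletion_two_of_sq_eq_neg_one` — `√−1 ∈ F ⇒ e_v ≥ 2` at every `v | 2`, read in
  abc-iut-S7's rescaled completion;
* **`thetaLocal_settingPrVolSharp_pos_at_two_of_sq_eq_neg_one`** — `0 < −|log(Θ)|_{i+1,2}` at `Real.settingPrVolSharp`
  whenever `√−1 ∈ F`, no place of `S` lies over `2`, and some `v | 2` has `e_v ≤ i+2`;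
* **`neg_ndegLgp_lt_negLogTheta_settingPrVolSharp_of_sq_eq_neg_one`** — then, for Θ-ideles realising `P_Θ`,
  `↑(−deĝ_lgp(P_Θ)) < −|log(Θ)|` STRICTLY (abc-iut-c312-7's `≤`, p426498, is never an equality at such a setting).
The remaining hypothesis `e_v ≤ i+2 ≤ ℓ⋆+1` (the amplification bound of the parent file) is a genuine restriction when the
dyadic ramification of `F` exceeds `ℓ⋆+1`; nothing is claimed there. HONEST SCOPE: Dupuy–Hilado's (Ind2) (all
shell-preserving lattice automorphisms of `I_v`); statements about OUR typed objects at the setting assembled from the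
typed definitions; the sign of `−|log(Θ)| − (−|log(q)|)` is NOT evaluated. [cite: Mochizuki2012, IUTchI Def. 3.1 (a)(b) p. 61]
[cite: DupuyHilado2025, §3.9, §4.9] [cite: NeukirchANT1999, Ch. II (7.13)] [claim: Mochizuki2012, status: disputed]
-/

noncomputable section

open Set Function NumberField IsDedekindDomain Metric
open scoped Pointwise

namespace Summit.ABC

namespace IUTFork

namespace Thm311

namespace Real

open Cor312 Cor312.Setting Cor312Vol Literature.IUT.LogThetaLattice Literature.IUT.LogVolume
open Literature.NumberTheory.NumberFields

variable {F : Type} [Field F] [NumberField F] (X : PilotData F) {logv : PadicLogs F} (hlog : LogvAnalytic logv)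

/-- **`√−1 ∈ F ⇒ e_v ≥ 2` at every place `v | 2`**, read in the rescaled completion `F_v` (the image of `√−1` is a square
root of `−1` in `F_v`; campaign-S `two_le_absRamificationIdx_two_of_sq_eq_neg_one`). [cite: NeukirchANT1999, Ch. II (7.13)] -/
theorem two_le_absRamificationIdx_rescaledCompletion_two_of_sq_eq_neg_one (r : F) (hr : r ^ 2 = -1)
    (v : HeightOneSpectrum (𝓞 F)) (hvp : ((2 : ℕ) : 𝓞 F) ∈ v.asIdeal) :
    haveI : Fact (Nat.Prime 2) := ⟨Nat.prime_two⟩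
    2 ≤ absRamificationIdx 2 (RescaledCompletion F 2 v hvp) := by
  haveI : Fact (Nat.Prime 2) := ⟨Nat.prime_two⟩
  refine two_le_absRamificationIdx_two_of_sq_eq_neg_one 2 (RescaledCompletion F 2 v hvp) rfl
    (i := RescaledCompletion.of F 2 v hvp (algebraMap F (v.adicCompletion F) r)) ?_
  rw [← map_pow, ← map_pow, hr, map_neg, map_one, map_neg, map_one]

variable (M : Type) [Field M] [NumberField M]
  (archPk : ∀ (j : (thetaIndex X).Label) (vQ : (thetaIndex X).VQ), Set ((logShellsDH X logv).Packet j vQ))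
  (archSub : ∀ (j : (thetaIndex X).Label) (v : (thetaIndex X).V),
    Set ((logShellsDH X logv).Packet j ((thetaIndex X).over v)))
  (Ψ : ℤ → ∀ v : (thetaIndex X).V, v ∈ (thetaIndex X).Vbad → Set ((logShellsDH X logv).StarPacket v))
  (act : ℤ → ∀ v : (thetaIndex X).V, v ∈ (thetaIndex X).Vbad →
    (logShellsDH X logv).StarPacket v → Module.End ℚ ((logShellsDH X logv).StarPacket v))
  (Mmod : ℤ → ∀ j : (thetaIndex X).LabelStar, Set ((logShellsDH X logv).GlobalPacket j.1))
  (region : ℤ → ∀ j : (thetaIndex X).LabelStar, FinDivisor M → ∀ vQ : (thetaIndex X).VQ,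
    Set ((logShellsDH X logv).Packet j.1 vQ))
  (n : ℤ)
  (t : ∀ (pp : Nat.Primes) (_ : Fin X.lstar) (x : (thetaIndex X).Fibre (.inr pp)),
    haveI : Fact (pp : ℕ).Prime := ⟨pp.2⟩; kOf X pp.1 x)
  (tq : ∀ (pp : Nat.Primes) (x : (thetaIndex X).Fibre (.inr pp)),
    haveI : Fact (pp : ℕ).Prime := ⟨pp.2⟩; kOf X pp.1 x)
  {HT : Type} {LogLink : HT → HT → Type} {IsFull : ∀ {s t : HT}, LogLink s t → Prop}
  (lat : LGPGaussianLogThetaLattice LogLink IsFull)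
  {Frd : Type} {IsoF : Frd → Frd → Type} {Ob : Frd → Type} {realify : Frd → Frd} {Strip : Type}
  {IsoS : Strip → Strip → Type} {Mv : ∀ v : (thetaIndex X).V, v ∈ (thetaIndex X).Vbad → Type}
  [∀ v h, Monoid (Mv v h)]
  (sig : GlobalLGPFrobenioidSignature (thetaIndex X).lstar (thetaIndex X).V (· ∈ (thetaIndex X).Vbad)
    Frd IsoF Ob realify Strip IsoS Mv)
  (split : SplittingMonoids Mv) {ObΔ : Type} {N : ∀ v : (thetaIndex X).V, v ∈ (thetaIndex X).Vbad → Type}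
  [∀ v h, Monoid (N v h)] (qData : QPilotData ObΔ N)

/-- **`0 < −|log(Θ)|_{i+1,2}` at the print-normalised sharp setting of record when `√−1 ∈ F`** ([IUTchI] Def. 3.1 (a)),
no place of `S` lies over `2` (Def. 3.1 (b): `𝕍^bad` of odd residue characteristic — then every Θ-box over `2` is `𝒪_L`),
and some place `v | 2` of `F` has `e_v ≤ |S^±_{i+2}| = i+2`: the dyadic instance of
`thetaLocal_settingPrVolSharp_pos_of_ramified`. [cite: Mochizuki2012, IUTchI Def. 3.1 (a)(b) p. 61]
[cite: DupuyHilado2025, §3.9, §4.9] [claim: Mochizuki2012, status: disputed] -/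
theorem thetaLocal_settingPrVolSharp_pos_at_two_of_sq_eq_neg_one (ht0 : ∀ pp i x, t pp i x ≠ 0)
    (ht1 : ∀ (pp : Nat.Primes) (i : Fin X.lstar) (x : (thetaIndex X).Fibre (.inr pp)),
      haveI : Fact (pp : ℕ).Prime := ⟨pp.2⟩; placeOf X pp.1 x ∉ X.S → ‖t pp i x‖ = 1)
    (htq0 : ∀ pp x, tq pp x ≠ 0)
    (htq1 : ∀ (pp : Nat.Primes) (x : (thetaIndex X).Fibre (.inr pp)),
      haveI : Fact (pp : ℕ).Prime := ⟨pp.2⟩; placeOf X pp.1 x ∉ X.S → ‖tq pp x‖ = 1)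
    (r : F) (hr : r ^ 2 = -1) (i : Fin (thetaIndex X).lstar)
    (hS : ∀ x : (thetaIndex X).Fibre (.inr ⟨2, Nat.prime_two⟩), placeOf X 2 x ∉ X.S)
    (v : HeightOneSpectrum (𝓞 F)) (hv : (thetaIndex X).over (.inr v) = .inr ⟨2, Nat.prime_two⟩)
    (hvp : ((2 : ℕ) : 𝓞 F) ∈ v.asIdeal)
    (hei : absRamificationIdx 2 (RescaledCompletion F 2 v hvp) ≤ Fintype.card ((thetaIndex X).Caps (Setting.labelSucc i))) :
    0 < (settingPrVolSharp X hlog M archPk archSub Ψ act Mmod region n lat sig split qData tq t htq0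
        htq1).thetaLocal (Setting.labelSucc i) (.inr ⟨2, Nat.prime_two⟩) :=
  thetaLocal_settingPrVolSharp_pos_of_ramified X hlog M archPk archSub Ψ act Mmod region n t tq lat sig split qData ht0 ht1
    htq0 htq1 i ⟨2, Nat.prime_two⟩ hS v hv hvp
    (two_le_absRamificationIdx_rescaledCompletion_two_of_sq_eq_neg_one r hr v hvp) hei

/-- **`−deĝ_lgp(P_Θ) < −|log(Θ)|` STRICTLY at the print-normalised sharp setting of record when `√−1 ∈ F`**, no place of
`S` lies over `2`, and some `v | 2` has `e_v ≤ i+2` for some label `i+1`, for Θ-ideles realising `P_Θ`: the dyadic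
instance of `neg_ndegLgp_lt_negLogTheta_settingPrVolSharp_of_ramified` — abc-iut-c312-7's `≤` (p426498) is never an
equality there. [cite: Mochizuki2012, IUTchI Def. 3.1 (a)(b) p. 61] [cite: DupuyHilado2025, §3.9, §4.9, Thm. 3.10.1]
[claim: Mochizuki2012, status: disputed] -/
theorem neg_ndegLgp_lt_negLogTheta_settingPrVolSharp_of_sq_eq_neg_one (ht0 : ∀ pp i x, t pp i x ≠ 0)
    (ht1 : ∀ (pp : Nat.Primes) (i : Fin X.lstar) (x : (thetaIndex X).Fibre (.inr pp)),
      haveI : Fact (pp : ℕ).Prime := ⟨pp.2⟩; placeOf X pp.1 x ∉ X.S → ‖t pp i x‖ = 1)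
    (ht : ∀ (pp : Nat.Primes) (i : Fin X.lstar) (x : (thetaIndex X).Fibre (.inr pp)),
      haveI : Fact (pp : ℕ).Prime := ⟨pp.2⟩
      Real.log ‖t pp i x‖ = -(X.thetaPilot i (placeOf X pp.1 x)) * logNorm F (placeOf X pp.1 x) /
        localDegree F (placeOf X pp.1 x))
    (htq0 : ∀ pp x, tq pp x ≠ 0)
    (htq1 : ∀ (pp : Nat.Primes) (x : (thetaIndex X).Fibre (.inr pp)),
      haveI : Fact (pp : ℕ).Prime := ⟨pp.2⟩; placeOf X pp.1 x ∉ X.S → ‖tq pp x‖ = 1)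
    (r : F) (hr : r ^ 2 = -1) (i : Fin (thetaIndex X).lstar)
    (hS : ∀ x : (thetaIndex X).Fibre (.inr ⟨2, Nat.prime_two⟩), placeOf X 2 x ∉ X.S)
    (v : HeightOneSpectrum (𝓞 F)) (hv : (thetaIndex X).over (.inr v) = .inr ⟨2, Nat.prime_two⟩)
    (hvp : ((2 : ℕ) : 𝓞 F) ∈ v.asIdeal)
    (hei : absRamificationIdx 2 (RescaledCompletion F 2 v hvp) ≤ Fintype.card ((thetaIndex X).Caps (Setting.labelSucc i))) :
    (((-LgpDivisor.ndegLgp X.thetaPilot : ℝ)) : WithTop ℝ) <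
      (settingPrVolSharp X hlog M archPk archSub Ψ act Mmod region n lat sig split qData tq t htq0 htq1).negLogTheta :=
  neg_ndegLgp_lt_negLogTheta_settingPrVolSharp_of_ramified X hlog M archPk archSub Ψ act Mmod region n t tq lat sig split
    qData ht0 ht1 ht htq0 htq1 i ⟨2, Nat.prime_two⟩ hS v hv hvp
    (two_le_absRamificationIdx_rescaledCompletion_two_of_sq_eq_neg_one r hr v hvp) hei

end Real

end Thm311

end IUTFork

end Summit.ABC

end
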